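import Mathlib
import HarnessLib

/-!
# Two-scale calculus (PM-IIa of LEAD memo `sfw-p2-g96-memo-24196-PM-design.md`): directional derivatives, their symmetry, Taylor along a line with
# integral remainder, and the TWO-VARIABLE HADAMARD STRUCTURE THEOREM `F(u, s) = u⁴·s²·Φ(u, s)` with `Φ` continuous
# (free-hands support of ⟨stmt-QuantumFields-24196⟩ `SwapVirialDeficit.ToronSoftnessSharp`; GENERIC real analysis, Mathlib only)

The periodic two-scale limit (brick PM of w3 g64's periodic massive-mode rung) rests on one analytic mechanism: a smooth non-negative function
`F(u, s)` of the two blow-up parameters whose value and `s`-derivative vanish on `{s = 0}` and whose first three `u`-derivatives vanish on `{u = 0}`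
factors as `F = u⁴s²·Φ` with `Φ` CONTINUOUS up to the axes — so that `{F ≤ u⁴s²} = {Φ ≤ 1}` has a JOINT limit as `(u, s) → (0, 0)` (LEAD memo §1).
This file proves that mechanism abstractly, on a real normed space `E` (for the memo, `E = ℝ × ℝ`), with the mixed partial `∂_s∂_u⁴ = ∂_u⁴∂_s`
handled by the symmetry of second derivatives applied to iterated DIRECTIONAL derivatives (no multilinear bookkeeping):
* §1 `dirDeriv v f p = fderiv ℝ f p v`, `dirDerivIter v k f = (dirDeriv v)^[k] f`; smoothness;
* §2 ★ `dirDeriv_comm` (`∂_v∂_w f = ∂_w∂_v f` for `C^∞` `f`, ✓`ContDiffAt.isSymmSndFDerivAt`), ★ `dirDeriv_dirDerivIter_comm`;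
* §3 ★ `iteratedDeriv_comp_line` — the `k`-th derivative of the slice `t ↦ f (p + t • v)` is `(∂_v^k f)(p + t • v)`; `dirDerivIter_eq_zero_of_line_zero`;
* §4 ★★ `taylor_line_integral` — `f (p + u • v) = Σ_{k ≤ n} uᵏ/k!·(∂_vᵏ f)(p) + uⁿ⁺¹/n!·∫₀¹ (1−t)ⁿ (∂_vⁿ⁺¹ f)(p + (t u) • v) dt`
  (✓`map_add_eq_sum_add_integral_iteratedFDeriv` on `ℝ` + §3);
* §5 (`E = ℝ × ℝ`, `eU = (1,0)`, `eS = (0,1)`, `mixedSix F = ∂_s²∂_u⁴F`, `twoScaleRemainder F u s = (1/6)∫₀¹(1−t)³∫₀¹(1−τ)·(∂_s²∂_u⁴F)(tu, τs) dτ dt`):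
  `eq_pow_four_mul_integral` (step 1), `dirDerivIter_four_eq_sq_mul_integral` (step 2, uses §2), and ★★★ `eq_pow_four_mul_sq_mul_twoScaleRemainder` —
  THE STRUCTURE THEOREM: if `F` is `C^∞`, `F(u,0) = 0`, `(∂_s F)(u,0) = 0` (all `u`) and `(∂_uᵏ F)(0,s) = 0` (`k < 4`, all `s`), then
  `F (u, s) = u⁴ · s² · twoScaleRemainder F u s` for ALL `(u, s)`;
* §6 ★ `continuous_twoScaleRemainder_param` (jointly continuous in `(x, u, s)` whenever the mixed sixth derivative is, any topological parameter space `X`),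
  `continuous_twoScaleRemainder`, ★★ `tendsto_div_pow_four_mul_sq` (`F/(u⁴s²) → Φ(0,0)` as `(u,s) → (0,0)` off the axes), `twoScaleRemainder_zero`
  (`Φ(0,0) = (∂_s²∂_u⁴F)(0,0)/48`).
HONEST LABEL: textbook calculus (plumbing for a plan-level fixed-`L` rung of a DRAFT line); nothing of PM, ⟨24196⟩ or ⟨24197⟩ is proved; own crux
⟨22884⟩ OPEN (blocked-on ⟨19935⟩); the Yang–Mills mass gap is NOT proved; no summit is proved by a line.
LEAD seat ym-line-sfw-p2 g96 (cell ym-idea-1, free hands), `--supports stmt-QuantumFields-24196`.  Four `def`s + two `abbrev`s, standard axioms, 0 `sorry`.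
References: [folklore] (Hadamard's lemma; Taylor's formula with integral remainder; Schwarz's theorem).
-/

set_option autoImplicit false

noncomputable section

open Set Filter Topology intervalIntegral
open scoped BigOperators ContDiff

namespace Summit.QuantumFields.YangMills.Theorems.SwapVirialDeficit.TwoScaleCalculus

variable {E : Type*} [NormedAddCommGroup E] [NormedSpace ℝ E]

/-! ## §1 Directional derivatives -/

/-- The directional derivative of `f : E → ℝ` along a fixed vector `v`: `(∂_v f)(p) = Df(p)[v]`. [folklore] -/
def dirDeriv (v : E) (f : E → ℝ) : E → ℝ := fun p => fderiv ℝ f p v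

/-- The `k`-fold directional derivative `∂_vᵏ f = (∂_v)^[k] f`. [folklore] -/
def dirDerivIter (v : E) (k : ℕ) (f : E → ℝ) : E → ℝ := (dirDeriv v)^[k] f

/-- `∂_v⁰ f = f`. [folklore] -/
@[simp] theorem dirDerivIter_zero (v : E) (f : E → ℝ) : dirDerivIter v 0 f = f := rfl

/-- `∂_vᵏ⁺¹ f = ∂_v (∂_vᵏ f)`. [folklore] -/
theorem dirDerivIter_succ (v : E) (k : ℕ) (f : E → ℝ) : dirDerivIter v (k + 1) f = dirDeriv v (dirDerivIter v k f) := by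
  unfold dirDerivIter; rw [Function.iterate_succ_apply']

/-- `∂_vᵏ⁺¹ f = ∂_vᵏ (∂_v f)`. [folklore] -/
theorem dirDerivIter_succ' (v : E) (k : ℕ) (f : E → ℝ) : dirDerivIter v (k + 1) f = dirDerivIter v k (dirDeriv v f) := by
  unfold dirDerivIter; rw [Function.iterate_succ_apply]

/-- A `C^∞` function has `C^∞` directional derivatives. [folklore] -/
theorem contDiff_dirDeriv {f : E → ℝ} (hf : ContDiff ℝ ∞ f) (v : E) : ContDiff ℝ ∞ (dirDeriv v f) := by
  unfold dirDeriv
  have h1 : ContDiff ℝ ∞ (fderiv ℝ f) := hf.fderiv_right (m := ∞) (by simp)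
  exact h1.clm_apply contDiff_const

/-- A `C^∞` function has `C^∞` iterated directional derivatives. [folklore] -/
theorem contDiff_dirDerivIter {f : E → ℝ} (hf : ContDiff ℝ ∞ f) (v : E) (k : ℕ) : ContDiff ℝ ∞ (dirDerivIter v k f) := by
  induction k with
  | zero => simpa using hf
  | succ k ih => rw [dirDerivIter_succ]; exact contDiff_dirDeriv ih v

/-- `∂_v` of a function vanishing on an open set vanishes there (locality of `fderiv`). [folklore] -/
theorem dirDeriv_eq_zero_of_eventuallyEq_zero {f : E → ℝ} {p : E} (h : f =ᶠ[𝓝 p] fun _ => 0) (v : E) : dirDeriv v f p = 0 := by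
  unfold dirDeriv
  rw [h.fderiv_eq, show (fun _ : E => (0 : ℝ)) = Function.const E 0 from rfl, fderiv_const]
  rfl

/-! ## §2 Symmetry of mixed directional derivatives -/

/-- ★ **Schwarz**: `∂_v (∂_w f) = ∂_w (∂_v f)` for `C^∞` `f` (✓`ContDiffAt.isSymmSndFDerivAt`). [folklore] -/
theorem dirDeriv_comm {f : E → ℝ} (hf : ContDiff ℝ ∞ f) (v w : E) : dirDeriv v (dirDeriv w f) = dirDeriv w (dirDeriv v f) := by
  funext p
  have hd : DifferentiableAt ℝ (fderiv ℝ f) p :=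
    ((hf.fderiv_right (m := ∞) (by simp)).differentiable (by simp)).differentiableAt
  have key : ∀ a b : E, dirDeriv a (dirDeriv b f) p = fderiv ℝ (fderiv ℝ f) p a b := by
    intro a b
    unfold dirDeriv
    rw [fderiv_clm_apply hd (differentiableAt_const b), fderiv_fun_const]
    simp
  rw [key, key]
  have h2 : minSmoothness ℝ 2 ≤ (∞ : ℕ∞ω) := by
    simp only [minSmoothness_of_isRCLikeNormedField]
    exact WithTop.coe_le_coe.mpr le_top
  have hsymm : IsSymmSndFDerivAt ℝ f p := hf.contDiffAt.isSymmSndFDerivAt h2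
  exact hsymm v w

/-- ★ `∂_v (∂_wᵏ f) = ∂_wᵏ (∂_v f)` for `C^∞` `f`. [folklore] -/
theorem dirDeriv_dirDerivIter_comm {f : E → ℝ} (hf : ContDiff ℝ ∞ f) (v w : E) (k : ℕ) :
    dirDeriv v (dirDerivIter w k f) = dirDerivIter w k (dirDeriv v f) := by
  induction k with
  | zero => rfl
  | succ k ih =>
      rw [dirDerivIter_succ, dirDerivIter_succ, dirDeriv_comm (contDiff_dirDerivIter hf w k) v w, ih]

/-! ## §3 Slices along a line -/

/-- The derivative of the slice `t ↦ f (p + t • v)` is the slice of `∂_v f` (✓`DifferentiableAt.deriv_comp_add_smul`). [folklore] -/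
theorem deriv_comp_line {f : E → ℝ} (hf : ContDiff ℝ ∞ f) (p v : E) :
    deriv (fun t : ℝ => f (p + t • v)) = fun t => dirDeriv v f (p + t • v) := by
  funext t
  unfold dirDeriv
  exact DifferentiableAt.deriv_comp_add_smul ((hf.differentiable (by simp)).differentiableAt)

/-- ★ **The `k`-th derivative of a slice is the slice of `∂_vᵏ`**: `(d/dt)ᵏ f (p + t • v) = (∂_vᵏ f)(p + t • v)`. [folklore] -/
theorem iteratedDeriv_comp_line {f : E → ℝ} (hf : ContDiff ℝ ∞ f) (p v : E) (k : ℕ) :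
    iteratedDeriv k (fun t : ℝ => f (p + t • v)) = fun t => dirDerivIter v k f (p + t • v) := by
  induction k with
  | zero => simp
  | succ k ih =>
      rw [iteratedDeriv_succ, ih, dirDerivIter_succ]
      exact deriv_comp_line (contDiff_dirDerivIter hf v k) p v

/-- The slice of a `C^∞` function is `C^∞`. [folklore] -/
theorem contDiff_comp_line {f : E → ℝ} (hf : ContDiff ℝ ∞ f) (p v : E) : ContDiff ℝ ∞ (fun t : ℝ => f (p + t • v)) :=
  hf.comp ((contDiff_const.add (contDiff_id.smul contDiff_const)))

/-- ★ If `f` vanishes along the whole line `p + ℝv`, then so does every `∂_vᵏ f`. [folklore] -/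
theorem dirDerivIter_eq_zero_of_line_zero {f : E → ℝ} (hf : ContDiff ℝ ∞ f) {p v : E} (h : ∀ t : ℝ, f (p + t • v) = 0) (k : ℕ) (t : ℝ) :
    dirDerivIter v k f (p + t • v) = 0 := by
  have e := iteratedDeriv_comp_line hf p v k
  have hz : (fun t : ℝ => f (p + t • v)) = fun _ => 0 := funext h
  rw [hz] at e
  have := congrFun e t
  simp only [iteratedDeriv_fun_const_zero] at this
  exact this.symm

/-! ## §4 Taylor along a line with integral remainder -/

/-- ★★ **Taylor's formula along a line, integral remainder**: for `C^∞` `f`,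
`f (p + u • v) = Σ_{k ≤ n} uᵏ/k! · (∂_vᵏ f)(p) + uⁿ⁺¹/n! · ∫₀¹ (1 − t)ⁿ · (∂_vⁿ⁺¹ f)(p + (t·u) • v) dt`. [folklore] -/
theorem taylor_line_integral {f : E → ℝ} (hf : ContDiff ℝ ∞ f) (p v : E) (u : ℝ) (n : ℕ) :
    f (p + u • v) = (∑ k ∈ Finset.range (n + 1), u ^ k / (k.factorial : ℝ) * dirDerivIter v k f p) +
      u ^ (n + 1) / (n.factorial : ℝ) * ∫ t in (0:ℝ)..1, (1 - t) ^ n * dirDerivIter v (n + 1) f (p + (t * u) • v) := by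
  set φ : ℝ → ℝ := fun t => f (p + t • v) with hφ
  have hφs : ContDiff ℝ ∞ φ := contDiff_comp_line hf p v
  have hT := map_add_eq_sum_add_integral_iteratedFDeriv (f := φ) (x := 0) (y := u) (n := n)
    (fun t _ => (hφs.of_le (by exact_mod_cast le_top)).contDiffAt)
  have hL : φ (0 + u) = f (p + u • v) := by simp [hφ]
  rw [← hL, hT]
  congr 1
  · refine Finset.sum_congr rfl fun k _ => ?_
    rw [iteratedFDeriv_apply_eq_iteratedDeriv_mul_prod, iteratedDeriv_comp_line hf p v k]
    simp only [Finset.prod_const, Finset.card_univ, Fintype.card_fin, smul_eq_mul, zero_smul, add_zero]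
    ring
  · have hI : ∀ t : ℝ, iteratedFDeriv ℝ (n + 1) φ (0 + t • u) (fun _ => u) = u ^ (n + 1) * dirDerivIter v (n + 1) f (p + (t * u) • v) := by
      intro t
      rw [iteratedFDeriv_apply_eq_iteratedDeriv_mul_prod, iteratedDeriv_comp_line hf p v (n + 1)]
      simp only [Finset.prod_const, Finset.card_univ, Fintype.card_fin, smul_eq_mul, zero_add]
    simp_rw [hI]
    rw [smul_eq_mul]
    have hc : ∫ t in (0:ℝ)..1, (1 - t) ^ n • (u ^ (n + 1) * dirDerivIter v (n + 1) f (p + (t * u) • v)) =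
        u ^ (n + 1) * ∫ t in (0:ℝ)..1, (1 - t) ^ n * dirDerivIter v (n + 1) f (p + (t * u) • v) := by
      rw [← intervalIntegral.integral_const_mul]
      refine intervalIntegral.integral_congr fun t _ => ?_
      simp only [smul_eq_mul]; ring
    rw [hc]
    ring


/-! ## §5 The structure theorem on `ℝ × ℝ` -/

section Plane

/-- The `u`-direction `(1, 0)` of the two-scale plane. [folklore] -/
abbrev eU : ℝ × ℝ := (1, 0)

/-- The `s`-direction `(0, 1)` of the two-scale plane. [folklore] -/
abbrev eS : ℝ × ℝ := (0, 1)

/-- `(0, s) + u • eU = (u, s)`. [folklore] -/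
@[simp] theorem base_add_smul_eU (u s : ℝ) : ((0 : ℝ), s) + u • eU = (u, s) := by
  ext <;> simp

/-- `(v, 0) + σ • eS = (v, σ)`. [folklore] -/
@[simp] theorem base_add_smul_eS (v σ : ℝ) : (v, (0 : ℝ)) + σ • eS = (v, σ) := by
  ext <;> simp

/-- The mixed sixth derivative `∂_s² ∂_u⁴ F` of the structure theorem. [folklore] -/
def mixedSix (F : ℝ × ℝ → ℝ) : ℝ × ℝ → ℝ := dirDerivIter eS 2 (dirDerivIter eU 4 F)

/-- **The two-scale remainder** `Φ(u, s) = (1/6)·∫₀¹ (1−t)³ · ∫₀¹ (1−τ) · (∂_s²∂_u⁴F)(t u, τ s) dτ dt`. [folklore] -/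
def twoScaleRemainder (F : ℝ × ℝ → ℝ) (u s : ℝ) : ℝ :=
  (1 / 6 : ℝ) * ∫ t in (0:ℝ)..1, (1 - t) ^ 3 * ∫ τ in (0:ℝ)..1, (1 - τ) * mixedSix F (t * u, τ * s)

/-- `mixedSix F` is `C^∞`. [folklore] -/
theorem contDiff_mixedSix {F : ℝ × ℝ → ℝ} (hF : ContDiff ℝ ∞ F) : ContDiff ℝ ∞ (mixedSix F) :=
  contDiff_dirDerivIter (contDiff_dirDerivIter hF eU 4) eS 2

/-- Step 1: the order-4 expansion in `u` with vanishing Taylor coefficients. [folklore] -/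
theorem eq_pow_four_mul_integral {F : ℝ × ℝ → ℝ} (hF : ContDiff ℝ ∞ F)
    (hU : ∀ k < 4, ∀ s : ℝ, dirDerivIter eU k F (0, s) = 0) (u s : ℝ) :
    F (u, s) = u ^ 4 / 6 * ∫ t in (0:ℝ)..1, (1 - t) ^ 3 * dirDerivIter eU 4 F (t * u, s) := by
  have hT := taylor_line_integral hF ((0 : ℝ), s) eU u 3
  rw [base_add_smul_eU] at hT
  have hsum : (∑ k ∈ Finset.range (3 + 1), u ^ k / (k.factorial : ℝ) * dirDerivIter eU k F (0, s)) = 0 := by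
    refine Finset.sum_eq_zero fun k hk => ?_
    rw [hU k (by simpa using Finset.mem_range.1 hk) s, mul_zero]
  rw [hT, hsum, zero_add]
  have h6 : ((3 : ℕ).factorial : ℝ) = 6 := by norm_num [Nat.factorial]
  rw [h6]
  congr 1
  refine intervalIntegral.integral_congr fun t _ => ?_
  congr 2
  ext <;> simp

/-- Step 2: `∂_u⁴F` vanishes to second order on `{s = 0}` and expands in `s`. [folklore] -/
theorem dirDerivIter_four_eq_sq_mul_integral {F : ℝ × ℝ → ℝ} (hF : ContDiff ℝ ∞ F)
    (h0 : ∀ u : ℝ, F (u, 0) = 0) (h1 : ∀ u : ℝ, dirDeriv eS F (u, 0) = 0) (v σ : ℝ) :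
    dirDerivIter eU 4 F (v, σ) = σ ^ 2 * ∫ τ in (0:ℝ)..1, (1 - τ) * mixedSix F (v, τ * σ) := by
  set A : ℝ × ℝ → ℝ := dirDerivIter eU 4 F with hA
  have hAs : ContDiff ℝ ∞ A := contDiff_dirDerivIter hF eU 4
  -- `A` vanishes on `{s = 0}`
  have hA0 : ∀ v : ℝ, A (v, 0) = 0 := by
    intro v
    have hl : ∀ t : ℝ, F (((0 : ℝ), (0 : ℝ)) + t • eU) = 0 := fun t => by rw [base_add_smul_eU]; exact h0 t
    have := dirDerivIter_eq_zero_of_line_zero hF hl 4 v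
    rwa [base_add_smul_eU] at this
  -- `∂_s A` vanishes on `{s = 0}` (Schwarz: `∂_s ∂_u⁴ F = ∂_u⁴ ∂_s F`)
  have hA1 : ∀ v : ℝ, dirDeriv eS A (v, 0) = 0 := by
    intro v
    rw [hA, dirDeriv_dirDerivIter_comm hF eS eU 4]
    have hl : ∀ t : ℝ, dirDeriv eS F (((0 : ℝ), (0 : ℝ)) + t • eU) = 0 := fun t => by rw [base_add_smul_eU]; exact h1 t
    have := dirDerivIter_eq_zero_of_line_zero (contDiff_dirDeriv hF eS) hl 4 v
    rwa [base_add_smul_eU] at this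
  have hT := taylor_line_integral hAs (v, (0 : ℝ)) eS σ 1
  rw [base_add_smul_eS] at hT
  rw [hT]
  have hsum : (∑ k ∈ Finset.range (1 + 1), σ ^ k / (k.factorial : ℝ) * dirDerivIter eS k A (v, 0)) = 0 := by
    rw [Finset.sum_range_succ, Finset.sum_range_succ, Finset.sum_range_zero]
    simp only [dirDerivIter_zero, hA0 v, mul_zero, zero_add]
    rw [show dirDerivIter eS 1 A = dirDeriv eS A from rfl, hA1 v, mul_zero]
  rw [hsum, zero_add]
  have h1f : ((1 : ℕ).factorial : ℝ) = 1 := by norm_num [Nat.factorial]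
  rw [h1f, div_one]
  congr 1
  refine intervalIntegral.integral_congr fun τ _ => ?_
  simp only [pow_one, mixedSix]
  congr 2
  ext <;> simp

/-- ★★★ **THE STRUCTURE THEOREM** `F(u, s) = u⁴ · s² · Φ(u, s)`: a `C^∞` function on the plane whose value and `s`-derivative vanish on `{s = 0}` and
whose `u`-derivatives of order `< 4` vanish on `{u = 0}` factors through `u⁴s²` with the CONTINUOUS quotient `Φ = twoScaleRemainder F`, for ALL `(u, s)`
(no exceptional set, no division). [folklore] -/
theorem eq_pow_four_mul_sq_mul_twoScaleRemainder {F : ℝ × ℝ → ℝ} (hF : ContDiff ℝ ∞ F)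
    (h0 : ∀ u : ℝ, F (u, 0) = 0) (h1 : ∀ u : ℝ, dirDeriv eS F (u, 0) = 0) (hU : ∀ k < 4, ∀ s : ℝ, dirDerivIter eU k F (0, s) = 0)
    (u s : ℝ) : F (u, s) = u ^ 4 * s ^ 2 * twoScaleRemainder F u s := by
  rw [eq_pow_four_mul_integral hF hU u s, twoScaleRemainder]
  have hin : ∫ t in (0:ℝ)..1, (1 - t) ^ 3 * dirDerivIter eU 4 F (t * u, s) =
      s ^ 2 * ∫ t in (0:ℝ)..1, (1 - t) ^ 3 * ∫ τ in (0:ℝ)..1, (1 - τ) * mixedSix F (t * u, τ * s) := by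
    rw [← intervalIntegral.integral_const_mul]
    refine intervalIntegral.integral_congr fun t _ => ?_
    show (1 - t) ^ 3 * dirDerivIter eU 4 F (t * u, s) = s ^ 2 * ((1 - t) ^ 3 * ∫ τ in (0:ℝ)..1, (1 - τ) * mixedSix F (t * u, τ * s))
    rw [dirDerivIter_four_eq_sq_mul_integral hF h0 h1 (t * u) s]
    ring
  rw [hin]
  ring

end Plane

/-! ## §6 Continuity of the remainder, with parameters -/

section Continuity

variable {X : Type*} [TopologicalSpace X]

/-- ★ **The two-scale remainder is jointly continuous** in `(x, u, s)` whenever the mixed sixth derivative is: for a continuous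
`H : X × (ℝ × ℝ) → ℝ`, `(x, u, s) ↦ (1/6)∫₀¹(1−t)³∫₀¹(1−τ)·H(x, (t u, τ s)) dτ dt` is continuous (✓`intervalIntegral.continuous_parametric_intervalIntegral_of_continuous'`, twice). [folklore] -/
theorem continuous_twoScaleRemainder_param {H : X × (ℝ × ℝ) → ℝ} (hH : Continuous H) :
    Continuous fun q : X × (ℝ × ℝ) =>
      (1 / 6 : ℝ) * ∫ t in (0:ℝ)..1, (1 - t) ^ 3 * ∫ τ in (0:ℝ)..1, (1 - τ) * H (q.1, (t * q.2.1, τ * q.2.2)) := by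
  -- inner integral, as a function of `(q, t)`
  have hinner : Continuous fun r : (X × (ℝ × ℝ)) × ℝ => ∫ τ in (0:ℝ)..1, (1 - τ) * H (r.1.1, (r.2 * r.1.2.1, τ * r.1.2.2)) := by
    refine intervalIntegral.continuous_parametric_intervalIntegral_of_continuous' ?_ 0 1
    have hc : Continuous fun z : ((X × (ℝ × ℝ)) × ℝ) × ℝ => (z.1.1.1, (z.1.2 * z.1.1.2.1, z.2 * z.1.1.2.2)) := by fun_prop
    exact (continuous_const.sub continuous_snd).mul (hH.comp hc)
  have houter : Continuous fun q : X × (ℝ × ℝ) => ∫ t in (0:ℝ)..1, (1 - t) ^ 3 * ∫ τ in (0:ℝ)..1, (1 - τ) * H (q.1, (t * q.2.1, τ * q.2.2)) := by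
    refine intervalIntegral.continuous_parametric_intervalIntegral_of_continuous' ?_ 0 1
    exact ((continuous_const.sub continuous_snd).pow 3).mul hinner
  exact continuous_const.mul houter

/-- ★ In particular `twoScaleRemainder F` is continuous on the plane for `C^∞` `F`. [folklore] -/
theorem continuous_twoScaleRemainder {F : ℝ × ℝ → ℝ} (hF : ContDiff ℝ ∞ F) :
    Continuous fun q : ℝ × ℝ => twoScaleRemainder F q.1 q.2 := by
  have hH : Continuous fun q : Unit × (ℝ × ℝ) => mixedSix F q.2 := (contDiff_mixedSix hF).continuous.comp continuous_snd
  have h := continuous_twoScaleRemainder_param hH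
  exact h.comp (continuous_const.prodMk continuous_id : Continuous fun q : ℝ × ℝ => ((), q))

/-- ★★ **THE JOINT LIMIT**: under the hypotheses of the structure theorem, `F(u, s)/(u⁴s²) → Φ(0, 0)` as `(u, s) → (0, 0)` through `u ≠ 0, s ≠ 0`,
and `Φ(0, 0) = twoScaleRemainder F 0 0 = (∂_s²∂_u⁴F)(0, 0)/48`. [folklore] -/
theorem tendsto_div_pow_four_mul_sq {F : ℝ × ℝ → ℝ} (hF : ContDiff ℝ ∞ F)
    (h0 : ∀ u : ℝ, F (u, 0) = 0) (h1 : ∀ u : ℝ, dirDeriv eS F (u, 0) = 0) (hU : ∀ k < 4, ∀ s : ℝ, dirDerivIter eU k F (0, s) = 0) :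
    Tendsto (fun q : ℝ × ℝ => F q / (q.1 ^ 4 * q.2 ^ 2)) (𝓝[{q | q.1 ≠ 0 ∧ q.2 ≠ 0}] (0, 0)) (𝓝 (twoScaleRemainder F 0 0)) := by
  have hc := (continuous_twoScaleRemainder hF).tendsto (0, 0)
  refine (hc.mono_left nhdsWithin_le_nhds).congr' ?_
  filter_upwards [self_mem_nhdsWithin] with q hq
  have hne : q.1 ^ 4 * q.2 ^ 2 ≠ 0 := mul_ne_zero (pow_ne_zero 4 hq.1) (pow_ne_zero 2 hq.2)
  rw [show F q = F (q.1, q.2) from rfl, eq_pow_four_mul_sq_mul_twoScaleRemainder hF h0 h1 hU q.1 q.2]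
  exact (mul_div_cancel_left₀ _ hne).symm

/-- The value at the origin: `Φ(0, 0) = (∂_s²∂_u⁴F)(0, 0)/48`. [folklore] -/
theorem twoScaleRemainder_zero (F : ℝ × ℝ → ℝ) : twoScaleRemainder F 0 0 = mixedSix F (0, 0) / 48 := by
  unfold twoScaleRemainder
  simp only [mul_zero]
  rw [intervalIntegral.integral_mul_const, intervalIntegral.integral_mul_const]
  have h3 : ∫ t in (0:ℝ)..1, (1 - t) ^ 3 = 1 / 4 := by norm_num [integral_comp_sub_left fun x => x ^ 3]
  have h1 : ∫ τ in (0:ℝ)..1, (1 - τ) = 1 / 2 := by norm_num [integral_comp_sub_left fun x => x]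
  rw [h3, h1]
  ring

end Continuity

end Summit.QuantumFields.YangMills.Theorems.SwapVirialDeficit.TwoScaleCalculus

end
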